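import Summits.Ventures.CertifiedManyBodySolver.Observables.PairLROTowerCharged
import Literature.MathematicalPhysics.QuantumLattice.TranslationSumCommutatorLocality
import Literature.MathematicalPhysics.QuantumLattice.SlaterWindowReducedDensityMatrix
import HarnessLib

/-!
# OP1-C, part 3: the `N̂` double-commutator input for a word of definite charge

HONEST FRAMING: first certified bounds on pairing observables; not a superconductivity verdict; a ceiling route,
never presence. Crew hubbard-obs (D-0042), seat hubbard-obs-p1 (`prover-hubbard-obs-p1-g8-0`). Zero compute; no
definition; no named fact; no `sorry`.

`liminf_pairFieldLRO_le_sq_of_onePoint_chargedStationary_bound_TT'` (PairLROTowerCharged) takes as input the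
`O(L²)` bounds `hDDN₁/₂` on the double commutators `[B_j,[B_j,N̂]]` of the two Hermitian parts
`B₁ = Σ_v T_v Γ_L(½(w + wᴴ))`, `B₂ = Σ_v T_v Γ_L((i/2)(wᴴ − w))` of the translation sum `W = Σ_v T_v Γ_L(w)`
with the particle number. For a word of DEFINITE CHARGE `q` — `N̂_{Λ_w} w − w N̂_{Λ_w} = −q·w`, e.g. a pair
annihilation word (`q = 2`), the case of the bootstrap's charged equation-of-motion rows — both double
commutators are `−(q/2)·(WW† − W†W)` (`doubleCommutator_totalNumber_eq_of_charge`), whose expectation is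
`O(L²)` by TranslationSumCommutatorLocality; hence `hDDN₁/₂` hold with `D_N = (|q|/2)·C`
(`exists_abs_re_doubleCommutator_totalNumber_le_of_charge`). Mechanism: the charge passes to the translation
sum (`totalNumberOp_commutator_fermionEmbed`, translation invariance of `N̂`), then
`[B₁,N̂] = (q/2)(W − W†)`, `[B₂,N̂] = −(iq/2)(W + W†)` and `[W ± W†, W ∓ W†] = ∓2[W, W†]`.

References: T. Koma, H. Tasaki, J. Stat. Phys. 76 (1994) 745, §2 [KomaTasaki1994]; O. Bratteli, D. W. Robinson,
*Operator Algebras and Quantum Statistical Mechanics 2* (1997) §5.2.2, §6.2.1 [BratteliRobinsonII1997].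
-/

noncomputable section

namespace Summit.Ventures.CertifiedManyBodySolver.Observables

open Matrix Complex Finset Literature.MathematicalPhysics.QuantumLattice Literature.Probability.LatticeModels
open Literature.MathematicalPhysics.QuantumLattice.HubbardWave0 ThermodynamicLimit Filter Topology
open scoped ComplexOrder ComplexConjugate BigOperators

section ChargedWord

variable {L : ℕ} [NeZero L] {Λw : Finset (Site 2)}

/-- **A charge-`q` local word has a charge-`q` translation sum**: `N̂_{Λ_w} w − w N̂_{Λ_w} = −q·w` gives
`N̂ W − W N̂ = −q·W` for `W = Σ_v T_v Γ_L(w)` (the charge of an embedded observable is the embedded charge,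
`totalNumberOp_commutator_fermionEmbed`; `N̂` is translation invariant). [cite: BratteliRobinsonII1997, §5.2.2] -/
theorem totalNumber_commutator_translationSum_of_charge (h : Set.InjOn (Torus.proj (d := 2) L) ↑Λw)
    (wloc : FermionOp Λw) {q : ℂ} (hq : totalNumberOp * wloc - wloc * totalNumberOp = -q • wloc) :
    totalNumber * (∑ v : TorusSite 2 L, relabel (Orb.translate v) (fermionEmbed (PolySite.toTorusEmb L h) wloc)) -
      (∑ v : TorusSite 2 L, relabel (Orb.translate v) (fermionEmbed (PolySite.toTorusEmb L h) wloc)) * totalNumber =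
      -q • (∑ v : TorusSite 2 L, relabel (Orb.translate v) (fermionEmbed (PolySite.toTorusEmb L h) wloc)) := by
  have hloc : (totalNumber : Matrix (Finset (Orb (FermionTorus 2 L))) (Finset (Orb (FermionTorus 2 L))) ℂ) *
      fermionEmbed (PolySite.toTorusEmb L h) wloc - fermionEmbed (PolySite.toTorusEmb L h) wloc * totalNumber =
      -q • fermionEmbed (PolySite.toTorusEmb L h) wloc := by
    rw [← totalNumberOp_eq_totalNumber, totalNumberOp_commutator_fermionEmbed, hq, fermionEmbed_smul]
  have hT : ∀ v : TorusSite 2 L, relabel (Orb.translate v)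
      (totalNumber : Matrix (Finset (Orb (FermionTorus 2 L))) (Finset (Orb (FermionTorus 2 L))) ℂ) = totalNumber :=
    fun v => by rw [Orb.translate, relabel_mapEquiv_totalNumber]
  rw [Finset.mul_sum, Finset.sum_mul, ← Finset.sum_sub_distrib, Finset.smul_sum]
  refine Finset.sum_congr rfl fun v _ => ?_
  rw [← hT v, ← relabel_mul, ← relabel_mul, ← relabel_sub, hloc, relabel_smul]

/-- The adjoint word has the opposite charge: `N̂₀ wᴴ − wᴴ N̂₀ = q·wᴴ` (for real `q`). [folklore] -/
theorem totalNumberOp_commutator_conjTranspose_of_charge (wloc : FermionOp Λw) {q : ℝ}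
    (hq : totalNumberOp * wloc - wloc * totalNumberOp = -(q : ℂ) • wloc) :
    totalNumberOp * wlocᴴ - wlocᴴ * totalNumberOp = -(-(q : ℂ)) • wlocᴴ := by
  have hNh : (totalNumberOp : FermionOp Λw).IsHermitian := by
    rw [totalNumberOp_eq_totalNumber]; exact totalNumber_isHermitian
  have h1 := congrArg conjTranspose hq
  rw [conjTranspose_sub, conjTranspose_mul, conjTranspose_mul, hNh.eq, conjTranspose_smul, star_neg,
    Complex.star_def, Complex.conj_ofReal] at h1
  rw [neg_neg, ← neg_sub, h1, neg_smul, neg_neg]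

/-- **The two double commutators with `N̂` of a charge-`q` word are `−(q/2)[W, W†]`.** With
`W = Σ_v T_v Γ_L(w)`, `W' = Σ_v T_v Γ_L(wᴴ)`, `N̂W − WN̂ = −qW`, `N̂W' − W'N̂ = qW'`, and the Hermitian parts
`B₁ = ½(W + W')`, `B₂ = (i/2)(W' − W)`: `[B_j,[B_j,N̂]] = −(q/2)(WW' − W'W)` for `j = 1, 2` (pure algebra).
[cite: KomaTasaki1994, §2] -/
theorem doubleCommutator_totalNumber_eq_of_charge {m : Type*} [Fintype m] [DecidableEq m]
    (W W' Nt : Matrix m m ℂ) (q : ℂ) (hW : Nt * W - W * Nt = -q • W) (hW' : Nt * W' - W' * Nt = q • W') :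
    ((1 / 2 : ℂ) • (W + W')) * (((1 / 2 : ℂ) • (W + W')) * Nt - Nt * ((1 / 2 : ℂ) • (W + W'))) -
        (((1 / 2 : ℂ) • (W + W')) * Nt - Nt * ((1 / 2 : ℂ) • (W + W'))) * ((1 / 2 : ℂ) • (W + W')) =
      -(q / 2) • (W * W' - W' * W) ∧
    ((I / 2 : ℂ) • (W' - W)) * (((I / 2 : ℂ) • (W' - W)) * Nt - Nt * ((I / 2 : ℂ) • (W' - W))) -
        (((I / 2 : ℂ) • (W' - W)) * Nt - Nt * ((I / 2 : ℂ) • (W' - W))) * ((I / 2 : ℂ) • (W' - W)) =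
      -(q / 2) • (W * W' - W' * W) := by
  -- the first commutators
  have hWN : W * Nt = Nt * W + q • W := by
    have := sub_eq_iff_eq_add.1 hW
    rw [this]; module
  have hW'N : W' * Nt = Nt * W' - q • W' := by
    have := sub_eq_iff_eq_add.1 hW'
    rw [this]; module
  have h1 : ((1 / 2 : ℂ) • (W + W')) * Nt - Nt * ((1 / 2 : ℂ) • (W + W')) = (q / 2) • (W - W') := by
    rw [Matrix.smul_mul, Matrix.mul_smul, Matrix.add_mul, Matrix.mul_add, hWN, hW'N]
    module
  have h2 : ((I / 2 : ℂ) • (W' - W)) * Nt - Nt * ((I / 2 : ℂ) • (W' - W)) = -(I * q / 2) • (W + W') := by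
    rw [Matrix.smul_mul, Matrix.mul_smul, Matrix.sub_mul, Matrix.mul_sub, hWN, hW'N]
    module
  refine ⟨?_, ?_⟩
  · rw [h1, Matrix.smul_mul, Matrix.mul_smul, Matrix.mul_smul, Matrix.smul_mul, Matrix.add_mul,
      Matrix.mul_add, Matrix.mul_sub, Matrix.mul_sub, Matrix.sub_mul, Matrix.sub_mul]
    module
  · rw [h2, Matrix.smul_mul, Matrix.mul_smul, Matrix.mul_smul, Matrix.smul_mul, Matrix.sub_mul,
      Matrix.mul_sub, Matrix.mul_add, Matrix.mul_add, Matrix.add_mul, Matrix.add_mul, smul_smul, smul_smul]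
    have hI : I / 2 * -(I * q / 2) = q / 4 := by
      rw [show I / 2 * -(I * q / 2) = -(I * I) * q / 4 by ring, I_mul_I]; ring
    rw [hI]
    module

/-- **The `N̂` double-commutator input of OP1-C for a charge-`q` word.** For a local word `w` with `w` even and
`N̂_{Λ_w} w − w N̂_{Λ_w} = −q·w` (`q` real): there are `D_N ≥ 0` and `L_N` such that for every side
`L ≥ L_N` on which `Λ_w` embeds, both Hermitian parts `B₁ = Σ_v T_v Γ_L(½(w + wᴴ))`,
`B₂ = Σ_v T_v Γ_L((i/2)(wᴴ − w))` satisfy `|Re⟨χ,[B_j,[B_j,N̂]]χ⟩| ≤ D_N·L²` for every unit `χ` — the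
hypotheses `hDDN₁/₂` of `liminf_pairFieldLRO_le_sq_of_onePoint_chargedStationary_bound_TT'`.
[cite: KomaTasaki1994, §2] [cite: BratteliRobinsonII1997, §6.2.1] -/
theorem exists_abs_re_doubleCommutator_totalNumber_le_of_charge (wloc : FermionOp Λw)
    (hweven : wloc ∈ carEvenSubalgebra (Finset.univ : Finset (Orb (PolySite Λw)))) {q : ℝ}
    (hq : totalNumberOp * wloc - wloc * totalNumberOp = -(q : ℂ) • wloc) :
    ∃ DN : ℝ, ∃ LN : ℕ, 0 ≤ DN ∧ ∀ (L : ℕ) [NeZero L], LN ≤ L →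
      ∀ (h : Set.InjOn (Torus.proj (d := 2) L) ↑Λw) (χ : Fock (Orb (FermionTorus 2 L))), star χ ⬝ᵥ χ = 1 →
      |(star χ ⬝ᵥ (((∑ v : TorusSite 2 L, relabel (Orb.translate v)
          (fermionEmbed (PolySite.toTorusEmb L h) (((1 / 2 : ℂ)) • (wloc + wlocᴴ)))) *
        ((∑ v : TorusSite 2 L, relabel (Orb.translate v)
          (fermionEmbed (PolySite.toTorusEmb L h) (((1 / 2 : ℂ)) • (wloc + wlocᴴ)))) * totalNumber -
          totalNumber * (∑ v : TorusSite 2 L, relabel (Orb.translate v)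
          (fermionEmbed (PolySite.toTorusEmb L h) (((1 / 2 : ℂ)) • (wloc + wlocᴴ))))) -
        ((∑ v : TorusSite 2 L, relabel (Orb.translate v)
          (fermionEmbed (PolySite.toTorusEmb L h) (((1 / 2 : ℂ)) • (wloc + wlocᴴ)))) * totalNumber -
          totalNumber * (∑ v : TorusSite 2 L, relabel (Orb.translate v)
          (fermionEmbed (PolySite.toTorusEmb L h) (((1 / 2 : ℂ)) • (wloc + wlocᴴ))))) *
        (∑ v : TorusSite 2 L, relabel (Orb.translate v)
          (fermionEmbed (PolySite.toTorusEmb L h) (((1 / 2 : ℂ)) • (wloc + wlocᴴ))))) *ᵥ χ)).re| ≤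
        DN * (L : ℝ) ^ 2 ∧
      |(star χ ⬝ᵥ (((∑ v : TorusSite 2 L, relabel (Orb.translate v)
          (fermionEmbed (PolySite.toTorusEmb L h) ((I / 2 : ℂ) • (wlocᴴ - wloc)))) *
        ((∑ v : TorusSite 2 L, relabel (Orb.translate v)
          (fermionEmbed (PolySite.toTorusEmb L h) ((I / 2 : ℂ) • (wlocᴴ - wloc)))) * totalNumber -
          totalNumber * (∑ v : TorusSite 2 L, relabel (Orb.translate v)
          (fermionEmbed (PolySite.toTorusEmb L h) ((I / 2 : ℂ) • (wlocᴴ - wloc))))) -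
        ((∑ v : TorusSite 2 L, relabel (Orb.translate v)
          (fermionEmbed (PolySite.toTorusEmb L h) ((I / 2 : ℂ) • (wlocᴴ - wloc)))) * totalNumber -
          totalNumber * (∑ v : TorusSite 2 L, relabel (Orb.translate v)
          (fermionEmbed (PolySite.toTorusEmb L h) ((I / 2 : ℂ) • (wlocᴴ - wloc))))) *
        (∑ v : TorusSite 2 L, relabel (Orb.translate v)
          (fermionEmbed (PolySite.toTorusEmb L h) ((I / 2 : ℂ) • (wlocᴴ - wloc))))) *ᵥ χ)).re| ≤
        DN * (L : ℝ) ^ 2 := by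
  obtain ⟨C, L₀, hC, hcomm⟩ := exists_norm_expect_commutator_sum_translate_le (d := 2) hweven wlocᴴ
  refine ⟨|q| / 2 * C, L₀, by positivity, fun L _ hL h χ hχ => ?_⟩
  -- the translation sums of `w`, `wᴴ` and their charges
  set W := ∑ v : TorusSite 2 L, relabel (Orb.translate v) (fermionEmbed (PolySite.toTorusEmb L h) wloc) with hWdef
  set W' := ∑ v : TorusSite 2 L, relabel (Orb.translate v) (fermionEmbed (PolySite.toTorusEmb L h) wlocᴴ)
    with hW'def
  have hW : totalNumber * W - W * totalNumber = -(q : ℂ) • W :=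
    totalNumber_commutator_translationSum_of_charge h wloc hq
  have hW' : totalNumber * W' - W' * totalNumber = (q : ℂ) • W' := by
    have := totalNumber_commutator_translationSum_of_charge h wlocᴴ
      (totalNumberOp_commutator_conjTranspose_of_charge wloc hq)
    rw [neg_neg] at this
    exact this
  -- the Hermitian parts as combinations of `W`, `W'`
  have hB₁ : (∑ v : TorusSite 2 L, relabel (Orb.translate v)
      (fermionEmbed (PolySite.toTorusEmb L h) (((1 / 2 : ℂ)) • (wloc + wlocᴴ)))) = (1 / 2 : ℂ) • (W + W') := by
    rw [hWdef, hW'def, ← Finset.sum_add_distrib, Finset.smul_sum]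
    refine Finset.sum_congr rfl fun v _ => ?_
    rw [fermionEmbed_smul, relabel_smul, fermionEmbed_add, relabel_add]
  have hB₂ : (∑ v : TorusSite 2 L, relabel (Orb.translate v)
      (fermionEmbed (PolySite.toTorusEmb L h) ((I / 2 : ℂ) • (wlocᴴ - wloc)))) = (I / 2 : ℂ) • (W' - W) := by
    rw [hWdef, hW'def, ← Finset.sum_sub_distrib, Finset.smul_sum]
    refine Finset.sum_congr rfl fun v _ => ?_
    rw [fermionEmbed_smul, relabel_smul, fermionEmbed_sub, relabel_sub]
  obtain ⟨e1, e2⟩ := doubleCommutator_totalNumber_eq_of_charge W W' totalNumber (q : ℂ) hW hW'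
  -- the locality bound on `[W, W']`
  have hbd : ‖expect (W * W' - W' * W) χ‖ ≤ C * (L : ℝ) ^ 2 := hcomm L hL h h χ hχ
  have hsm : ∀ X : Matrix (Finset (Orb (FermionTorus 2 L))) (Finset (Orb (FermionTorus 2 L))) ℂ,
      |(star χ ⬝ᵥ ((-((q : ℂ) / 2) • X) *ᵥ χ)).re| = |q| / 2 * ‖((star χ ⬝ᵥ (X *ᵥ χ)).re : ℝ)‖ := by
    intro X
    rw [smul_mulVec, dotProduct_smul, smul_eq_mul, show -((q : ℂ) / 2) = ((-(q / 2) : ℝ) : ℂ) by push_cast; ring,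
      Complex.re_ofReal_mul, abs_mul, abs_neg, abs_div, abs_two, Real.norm_eq_abs]
  have hre : |(star χ ⬝ᵥ ((W * W' - W' * W) *ᵥ χ)).re| ≤ C * (L : ℝ) ^ 2 :=
    (Complex.abs_re_le_norm _).trans hbd
  refine ⟨?_, ?_⟩
  · rw [hB₁, e1, hsm, Real.norm_eq_abs, mul_assoc]
    exact mul_le_mul_of_nonneg_left hre (by positivity)
  · rw [hB₂, e2, hsm, Real.norm_eq_abs, mul_assoc]
    exact mul_le_mul_of_nonneg_left hre (by positivity)

/-- **The one-point size of the charge of `W_L` for a charge-`q` word** (the input `hWq` of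
`liminf_pairFieldLRO_le_sq_of_onePoint_chargedStationary_bound_TT'_near`): `N̂₀w − wN̂₀ = −q·w` gives
`|Re⟨ζ,(N̂W_L − W_LN̂)ζ⟩| = |q|·|Re⟨ζ,W_Lζ⟩| ≤ |q|·(Σ_{s,t}|w_{st}|)·L²` for every unit `ζ` (the translation
sum has expectation `L² ×` an averaged torus expectation of the fixed local matrix `w`).
[cite: BratteliRobinsonII1997, §6.2.1] -/
theorem abs_re_expect_totalNumber_commutator_translationSum_le_of_charge
    (h : Set.InjOn (Torus.proj (d := 2) L) ↑Λw) (wloc : FermionOp Λw) {q : ℝ}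
    (hq : totalNumberOp * wloc - wloc * totalNumberOp = -(q : ℂ) • wloc)
    (ζ : Fock (Orb (FermionTorus 2 L))) (hζ : star ζ ⬝ᵥ ζ = 1) :
    |(star ζ ⬝ᵥ ((totalNumber *
        (∑ v : TorusSite 2 L, relabel (Orb.translate v) (fermionEmbed (PolySite.toTorusEmb L h) wloc)) -
      (∑ v : TorusSite 2 L, relabel (Orb.translate v) (fermionEmbed (PolySite.toTorusEmb L h) wloc)) *
        totalNumber) *ᵥ ζ)).re| ≤ (|q| * ∑ s, ∑ t, ‖wloc s t‖) * (L : ℝ) ^ 2 := by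
  rw [totalNumber_commutator_translationSum_of_charge h wloc hq]
  have hexp : star ζ ⬝ᵥ ((∑ v : TorusSite 2 L, relabel (Orb.translate v)
      (fermionEmbed (PolySite.toTorusEmb L h) wloc)) *ᵥ ζ) = ((L : ℂ) ^ 2) * torusAvgExpectAt L Λw wloc ζ :=
    expect_sum_relabel_translate_fermionEmbed' L h wloc ζ
  rw [smul_mulVec, dotProduct_smul, smul_eq_mul, hexp]
  have hnorm : ‖torusAvgExpectAt L Λw wloc ζ‖ ≤ ∑ s, ∑ t, ‖wloc s t‖ := norm_torusAvgExpectAt_le_sum_norm L Λw wloc hζ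
  calc |(-(q : ℂ) * ((L : ℂ) ^ 2 * torusAvgExpectAt L Λw wloc ζ)).re|
      ≤ ‖-(q : ℂ) * ((L : ℂ) ^ 2 * torusAvgExpectAt L Λw wloc ζ)‖ := Complex.abs_re_le_norm _
    _ = |q| * (L : ℝ) ^ 2 * ‖torusAvgExpectAt L Λw wloc ζ‖ := by
        rw [norm_mul, norm_mul, norm_neg, Complex.norm_real, Real.norm_eq_abs, norm_pow, Complex.norm_natCast,
          mul_assoc]
    _ ≤ |q| * (L : ℝ) ^ 2 * ∑ s, ∑ t, ‖wloc s t‖ := mul_le_mul_of_nonneg_left hnorm (by positivity)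
    _ = (|q| * ∑ s, ∑ t, ‖wloc s t‖) * (L : ℝ) ^ 2 := by ring

end ChargedWord

end Summit.Ventures.CertifiedManyBodySolver.Observables

end
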